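import Literature.Probability.RandomPlanarGeometry.SAWSubBallistic
import HarnessLib

/-!
# Duminil-Copin–Glazman–Hammond–Manolescu 2016: the endpoint of self-avoiding walk delocalises

Topic `Literature/Probability/RandomPlanarGeometry` (continues `SAWCount.lean` / `SAWSubBallistic.lean`:
the function model `saws d n` of the `n`-step self-avoiding walks from `0` on `ℤ^d`, `#saws d n = cₙ =
count d n`, `countAt d n x = cₙ(x)`, the Euclidean norm `euclidNorm`). Source, read in the arXiv version
(locators `pNNNN:Lk` = chunk : line of the held text `paper:arxiv-1305.1257`):

H. Duminil-Copin, A. Glazman, A. Hammond, I. Manolescu, *On the probability that self-avoiding walk ends at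
a given point*, Ann. Probab. **44** (2016) 955–983, arXiv:1305.1257.

* §1.1 (p0003:L19–26): "Let `d ≥ 2`. For `u ∈ ℝ^d`, let `‖u‖` denote the Euclidean norm of `u`. … Let
  `SAW_n` denote the set of self-avoiding walks of length `n` that start at `0`. We denote by `P_{SAW_n}`
  the uniform law on `SAW_n` … The walk under the law `P_{SAW_n}` will be denoted by `Γ`."
* **Theorem 1.1** (p0003:L61–64): "Let `d ≥ 2`. For any `ε > 0` and `n` large enough,
  `P_{SAW_n}(‖Γ_n‖ = 1) ≤ n^{-1/4+ε}`."  (p0003:L66: "`P_{SAW_n}(‖Γ_n‖ = 1)` equals `n p_n / c_n`".)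
* (1.1) (p0003:L88–94), stated there as EXPECTED and NOT proved: "for any fixed point `x`,
  `P_{SAW_n}(Γ_n = x) ≤ n^{-1/4+ε}` for any `n` large enough" — not vendored.
* **Theorem 1.2** (p0004:L10–12): "Let `d ≥ 2`. As `n → ∞`, `sup_{x ∈ ℤ^d} P_{SAW_n}(Γ_n = x) → 0`."
* Proposition 1.3 (p0004:L26–31, midpoint delocalisation `sup_x P_{SAW_n}(Γ_{⌊n/2⌋} = x) ≤ C n^{-1/2}`) —
  not vendored here.

## What is vendored

Two NAMED FACTS in the tree's vocabulary, probabilities under the uniform law written as ratios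
`#(event)/cₙ`:

* `DGHM2016_thm1_1` — Theorem 1.1 verbatim ("for `n` large enough" = `∃ n₀ ∀ n ≥ n₀`; the event
  `‖Γ_n‖ = 1` is `closingWalks d n`, the walks whose endpoint has Euclidean norm `1`).
* `DGHM2016_thm1_2` — Theorem 1.2, with "`sup_x P_{SAW_n}(Γ_n = x) → 0`" unfolded as "for every `η > 0`,
  for all large `n`, `cₙ(x)/cₙ ≤ η` for every `x`" (literally equivalent to the convergence of the
  supremum to `0` for these nonnegative quantities, and free of `iSup` side conditions).

Local definition: `closingWalks d n` (+ `mem_closingWalks`, `card_closingWalks_le`, and the non-vacuity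
/ sanity lemma `closingWalks_one : closingWalks d 1 = saws d 1`).

## References

* H. Duminil-Copin, A. Glazman, A. Hammond, I. Manolescu, Ann. Probab. 44 (2016) 955–983,
  doi:10.1214/14-AOP993, arXiv:1305.1257 — Thm 1.1, Thm 1.2. [DuminilCopinGlazmanHammondManolescu2016]
* N. Madras, G. Slade, *The Self-Avoiding Walk*, Birkhäuser (1993), §1.1. [MadrasSlade1993]
-/

noncomputable section

open Filter Topology Literature.Probability.LatticeModels Literature.Probability.Percolation SimpleGraph
open scoped BigOperators

namespace Literature.Probability.RandomPlanarGeometry.SAW.Zd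

variable {d : ℕ}

/-! ### The event `‖Γ_n‖ = 1` -/

open Classical in
/-- The `n`-step self-avoiding walks from `0` whose endpoint is a nearest neighbour of the origin
(`‖Γ_n‖ = 1`, Euclidean norm); their number is `Σ_{‖x‖ = 1} cₙ(x) = n pₙ` in the source's notation
(p0003:L66). [cite: DuminilCopinGlazmanHammondManolescu2016, Thm 1.1] -/
def closingWalks (d n : ℕ) : Finset (ℕ → Site d) :=
  (saws d n).filter fun ω => euclidNorm (ω n) = 1

/-- Unfolding `closingWalks`. [cite: DuminilCopinGlazmanHammondManolescu2016, Thm 1.1] -/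
theorem mem_closingWalks {n : ℕ} {ω : ℕ → Site d} :
    ω ∈ closingWalks d n ↔ ω ∈ saws d n ∧ euclidNorm (ω n) = 1 := by
  classical
  exact Finset.mem_filter

/-- `#(closing walks) ≤ cₙ`, i.e. `P_{SAW_n}(‖Γ_n‖ = 1) ≤ 1`.
[cite: DuminilCopinGlazmanHammondManolescu2016, Thm 1.1] -/
theorem card_closingWalks_le (d n : ℕ) : (closingWalks d n).card ≤ count d n := by
  classical
  rw [closingWalks, ← card_saws]
  exact Finset.card_filter_le _ _

/-- Sanity / non-vacuity: every one-step walk ends at distance `1`, so `P_{SAW_1}(‖Γ_1‖ = 1) = 1` (the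
bound of Theorem 1.1 is about large `n`). [cite: DuminilCopinGlazmanHammondManolescu2016, Thm 1.1] -/
theorem closingWalks_one : closingWalks d 1 = saws d 1 := by
  classical
  refine Finset.filter_true_of_mem fun ω hω => ?_
  obtain ⟨h0, -, hadj, -⟩ := mem_saws.1 hω
  have h01 : (zdGraph d).Adj 0 (ω 1) := by simpa [h0] using hadj 0 Nat.one_pos
  exact euclidNorm_eq_one_of_adj_zero h01

/-! ### Theorems 1.1 and 1.2 -/

/-- NAMED FACT — **Duminil-Copin–Glazman–Hammond–Manolescu 2016, Theorem 1.1**: "Let `d ≥ 2`. For any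
`ε > 0` and `n` large enough, `P_{SAW_n}(‖Γ_n‖ = 1) ≤ n^{-1/4+ε}`", `P_{SAW_n}` the uniform law on the
`n`-step self-avoiding walks from `0` in `ℤ^d`, `‖·‖` the Euclidean norm (so the probability is
`#(closingWalks d n)/cₙ = n pₙ/cₙ`). Users take `(h : DGHM2016_thm1_1)`.
[cite: DuminilCopinGlazmanHammondManolescu2016, Thm 1.1] -/
def DGHM2016_thm1_1 : Prop :=
  ∀ d : ℕ, 2 ≤ d → ∀ ε : ℝ, 0 < ε → ∃ n₀ : ℕ, ∀ n : ℕ, n₀ ≤ n →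
    ((closingWalks d n).card : ℝ) / (count d n : ℝ) ≤ (n : ℝ) ^ (-(1 / 4 : ℝ) + ε)

/-- NAMED FACT — **Duminil-Copin–Glazman–Hammond–Manolescu 2016, Theorem 1.2** (uniform endpoint
delocalisation, no rate): "Let `d ≥ 2`. As `n → ∞`, `sup_{x ∈ ℤ^d} P_{SAW_n}(Γ_n = x) → 0`", i.e. for every
`η > 0` there is `n₀` with `cₙ(x)/cₙ ≤ η` for all `n ≥ n₀` and all `x ∈ ℤ^d` (`P_{SAW_n}(Γ_n = x) =
cₙ(x)/cₙ`). Users take `(h : DGHM2016_thm1_2)`. [cite: DuminilCopinGlazmanHammondManolescu2016, Thm 1.2] -/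
def DGHM2016_thm1_2 : Prop :=
  ∀ d : ℕ, 2 ≤ d → ∀ η : ℝ, 0 < η → ∃ n₀ : ℕ, ∀ n : ℕ, n₀ ≤ n → ∀ x : Site d,
    (countAt d n x : ℝ) / (count d n : ℝ) ≤ η

end Literature.Probability.RandomPlanarGeometry.SAW.Zd

end
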